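import Summits.QuantumFields.BalabanUV.Beta.GAN24.SavgInverseUniform
import Summits.QuantumFields.BalabanUV.Beta.GAN24.MinimiserOneStepDecay

/-!
# G-an2-4 ∕ (CONV-C), road P2 — INTERFACE REQUEST (U-SINV), file 3: THE HARD MINIMISER'S KERNEL LAW WITH ITS TWO UNIT-LATTICE BINDERS
# DISCHARGED — `MinimiserOneStepDecay.fieldDecay_Mhard_succ_sub_stair` now displays only the five fine-lattice letters

G-an2-4 formalisation swarm, leaf seat `b2b-balaban-gan24-formalise-leaf-03` (gen 49).  The requester's kernel-currency END
`MinimiserOneStepDecay.fieldDecay_Mhard_succ_sub_stair` (road P2 owner gan24-p2 gen 29, p257333) takes, besides the five fine-lattice letters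
`B₁ B₂ C₁ C₂ C₀` in `RowDecay` form at rate `δ`, the two unit-lattice binders `hS : RowDecay M id id (Savg N M a′)⁻¹ σ δ` and
`hS′ : RowDecay M id id (Savg (R·N) M a′)⁻¹ σ′ δ`.  File 2 (`SavgInverseUniform`, p259308 ∕ p259536) proves them for EVERY `n` and EVERY torus
at the rate `deltaS d a′` with the constant `sigmaS d a′`; `RowDecay` is monotone in the rate.  THIS FILE is the junction, BY NAME:
 * **`fieldDecay_Mhard_succ_sub_stair_uniform`** — the END with `hS`, `hS′` DISCHARGED (`σ = σ′ = sigmaS d a′`), for letters at any rate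
   `0 < δ ≤ deltaS d a′` (take `δ := min(δ_letters, deltaS d a′)` and `RowDecay.mono` on the letters otherwise); conclusion = the requester's,
   letter for letter, at rate `δ/32`;
 * **`norm_Mhard_succ_sub_stair_apply_le_uniform`** — its kernel reading at the indicator source `v = δ_{y′}`
   (`MinimiserOneStepDecay.fieldDecay_single`): `‖(H′ − J·H)(x′, y′)‖ ≤ C·e^{−(δ/32)·|blockOf x′ − y′|_{T,∞}}` with the displayed constant.
HONEST SCOPE.  [folklore] two-line junction of tree theorems BY NAME; scalar `U = 1` prototype; CONDITIONAL on the five fine-lattice letters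
(the (B5-1112-LOG) ∕ (α) ∕ (L0) chains and the requested (SCALAR-LETTERS-LOC) export supply them on cubic tori — not here); discharges
NOTHING of (CONV-C) as typed; NEVER «G-an2-4 closed»; NOT NE2, NOT D1, NOT BetaPertH, NOT continuum, NOT Clay; 0 def, 0 cite, 0 sorry —
not in print, our bookkeeping.  HONEST DEPENDENCY: continuum YM on T⁴ ⇐ BetaPertH ∧ nine spine estimates (0/9 proved); BetaPertH ⇐ (D1) ∧
(D4) ∧ CAP+tail; G-an2-4 gates asym, D1 and NE2/3/4.
-/

noncomputable section

open scoped BigOperators ComplexConjugate Matrix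

namespace Summit.QuantumFields.BalabanUV.Beta.GAN24.SavgInverseUniformHard

open Literature.MathematicalPhysics.QuantumFieldTheory.Balaban1983to89
open B5Prop11Plancherel (Tor fine)
open B5Action121 (sdiff)
open B5Blocks16 (blockOf)
open B4Sect5Proof (latticeConst)
open Summit.QuantumFields.BalabanUV.T4Continuum.ScalarAveragedPropagator (Gps)
open Summit.QuantumFields.BalabanUV.Beta.GAN24.StaircaseLaplacianDefect (stair)
open Summit.QuantumFields.BalabanUV.Beta.GAN24.HardMinimiserOneStepSup (Savg Mhard)
open Summit.QuantumFields.BalabanUV.Beta.GAN24.BlockFieldDecay (RowDecay FieldDecay)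
open Summit.QuantumFields.BalabanUV.Beta.GAN24.MinimiserOneStepDecay (epsSoft fieldDecay_Mhard_succ_sub_stair fieldDecay_single)
open Summit.QuantumFields.BalabanUV.Beta.GAN24.SavgInverseUniform (sigmaS deltaS sigmaS_pos deltaS_pos rowDecay_Savg_inv_of_le)

variable {d : ℕ} (N R : ℕ) [NeZero N] [NeZero R] (M : Fin (d + 1) → ℕ) [hM : ∀ μ, NeZero (M μ)]

/-- **THE HARD LAW WITH DECAY, `hS` ∕ `hS′` DISCHARGED** (`σ = σ′ = sigmaS d a′`): for letters `B₁ B₂ C₁ C₂ C₀` in `RowDecay` form at any rate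
`0 < δ ≤ deltaS d a′` and a source `v` with `|v(z)| ≤ V·e^{−δ|z − y′|}`, the one-step defect of the hard scalar minimiser decays from `y′` at rate
`δ/32` with `MinimiserOneStepDecay.fieldDecay_Mhard_succ_sub_stair`'s constant — every `N, R ≥ 1`, every torus `M : Fin (d+1) → ℕ`, every `a′ > 0`.
[folklore] -/
theorem fieldDecay_Mhard_succ_sub_stair_uniform {a' : ℝ} (ha' : 0 < a') {B₁ B₂ C₁ C₂ C₀ δ V : ℝ} (hδ : 0 < δ) (hδS : δ ≤ deltaS d a')
    (hB₁ : ∀ μ, RowDecay M (blockOf (R * N) M) (blockOf (R * N) M)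
      (Gps (R * N) M a' * (sdiff (fine (R * N) M) ((R * N : ℕ) : ℂ) μ)ᴴ * (sdiff (fine (R * N) M) ((R * N : ℕ) : ℂ) μ)ᴴ) B₁ δ)
    (hB₂ : ∀ μ, RowDecay M (blockOf (R * N) M) (blockOf (R * N) M)
      (Gps (R * N) M a' * (sdiff (fine (R * N) M) ((R * N : ℕ) : ℂ) μ)ᴴ) B₂ δ)
    (hC₁ : ∀ μ, RowDecay M (blockOf N M) (blockOf N M) (sdiff (fine N M) ((N : ℕ) : ℂ) μ * Gps N M a') C₁ δ)
    (hC₂ : ∀ μ, RowDecay M (blockOf N M) (blockOf N M)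
      ((sdiff (fine N M) ((N : ℕ) : ℂ) μ)ᴴ * sdiff (fine N M) ((N : ℕ) : ℂ) μ * Gps N M a') C₂ δ)
    (hC₀ : RowDecay M (blockOf N M) (blockOf N M) (Gps N M a') C₀ δ)
    {v : Tor M → ℂ} {y' : Tor M} (hV : 0 ≤ V) (hv : FieldDecay M id v V δ y') :
    FieldDecay M (blockOf (R * N) M) (Mhard (R * N) M a' *ᵥ v - stair N R M *ᵥ (Mhard N M a' *ᵥ v))
      (epsSoft d N R a' B₁ B₂ C₁ C₂ (δ / 2) * (sigmaS d a' * V * latticeConst (d + 1) (δ / 2))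
        + C₀ * (a' * (sigmaS d a' * (epsSoft d N R a' B₁ B₂ C₁ C₂ (δ / 2) * (sigmaS d a' * V * latticeConst (d + 1) (δ / 2)))
            * latticeConst (d + 1) (δ / 16))) * latticeConst (d + 1) (δ / 32))
      (δ / 32) y' :=
  fieldDecay_Mhard_succ_sub_stair N R M ha' hδ hB₁ hB₂ hC₁ hC₂ hC₀
    (rowDecay_Savg_inv_of_le N M ha' hδS) (rowDecay_Savg_inv_of_le (R * N) M ha' hδS) hV hv

/-- **THE HARD MINIMISER'S ONE-STEP KERNEL DECAYS, modulo the five fine-lattice letters only**: at the indicator source `v = δ_{y′}`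
(`V = 1`, any rate): `‖((H′ − J·H) δ_{y′})(x′)‖ ≤ C(d,a′,N,R,letters,δ)·e^{−(δ/32)·|blockOf x′ − y′|_{T,∞}}`, for letters at any rate
`0 < δ ≤ deltaS d a′`. [folklore] -/
theorem norm_Mhard_succ_sub_stair_apply_le_uniform {a' : ℝ} (ha' : 0 < a') {B₁ B₂ C₁ C₂ C₀ δ : ℝ} (hδ : 0 < δ) (hδS : δ ≤ deltaS d a')
    (hB₁ : ∀ μ, RowDecay M (blockOf (R * N) M) (blockOf (R * N) M)
      (Gps (R * N) M a' * (sdiff (fine (R * N) M) ((R * N : ℕ) : ℂ) μ)ᴴ * (sdiff (fine (R * N) M) ((R * N : ℕ) : ℂ) μ)ᴴ) B₁ δ)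
    (hB₂ : ∀ μ, RowDecay M (blockOf (R * N) M) (blockOf (R * N) M)
      (Gps (R * N) M a' * (sdiff (fine (R * N) M) ((R * N : ℕ) : ℂ) μ)ᴴ) B₂ δ)
    (hC₁ : ∀ μ, RowDecay M (blockOf N M) (blockOf N M) (sdiff (fine N M) ((N : ℕ) : ℂ) μ * Gps N M a') C₁ δ)
    (hC₂ : ∀ μ, RowDecay M (blockOf N M) (blockOf N M)
      ((sdiff (fine N M) ((N : ℕ) : ℂ) μ)ᴴ * sdiff (fine N M) ((N : ℕ) : ℂ) μ * Gps N M a') C₂ δ)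
    (hC₀ : RowDecay M (blockOf N M) (blockOf N M) (Gps N M a') C₀ δ)
    (x' : Tor (fine (R * N) M)) (y' : Tor M) :
    ‖(Mhard (R * N) M a' *ᵥ Pi.single y' (1 : ℂ) - stair N R M *ᵥ (Mhard N M a' *ᵥ Pi.single y' (1 : ℂ))) x'‖
      ≤ (epsSoft d N R a' B₁ B₂ C₁ C₂ (δ / 2) * (sigmaS d a' * 1 * latticeConst (d + 1) (δ / 2))
          + C₀ * (a' * (sigmaS d a' * (epsSoft d N R a' B₁ B₂ C₁ C₂ (δ / 2) * (sigmaS d a' * 1 * latticeConst (d + 1) (δ / 2)))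
              * latticeConst (d + 1) (δ / 16))) * latticeConst (d + 1) (δ / 32))
        * Real.exp (-(δ / 32 * B4TorusKernel.MultiPeriod.torusSupNorm M
            (B6LowerBound2153Torus.rep M (blockOf (R * N) M x') - B6LowerBound2153Torus.rep M y'))) :=
  fieldDecay_Mhard_succ_sub_stair_uniform N R M ha' hδ hδS hB₁ hB₂ hC₁ hC₂ hC₀ zero_le_one (fieldDecay_single (M := M) δ y') x'

end Summit.QuantumFields.BalabanUV.Beta.GAN24.SavgInverseUniformHard

end
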